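import Mathlib
import Summits.ResolutionOfSingularities.ResolutionOfSingularities.Theorems.RadicialJungCleanModelsCleanPatchingDefs
import Summits.ResolutionOfSingularities.ResolutionOfSingularities.Theorems.RadicialJungCleanModelsChartStalkSubring
import Literature.AlgebraicGeometry.Resolution.ProjectiveModelsCharts
import Literature.AlgebraicGeometry.Resolution.ValuativeDivisibility
import Literature.AlgebraicGeometry.Resolution.ResolutionProjectiveReduction
import HarnessLib

/-!
# Route `RadicialJung`, crux `CleanModels` (stmt-ResolutionOfSingularities-15917), line `Sketch` rev 15, stub 4c
# `stub_cleanGlobalization3`: the projective closure of a CLEAN CHART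

The `P_clean` twin of `ProjModel.exists_regCentre_of_hasRegularCentre` (`ProjectiveModelsCharts.lean`): a finitely
generated `k`-subalgebra `T ⊆ K` with `Frac T = K` ALL of whose local rings `locAtCentre T O'` are clean-regular for the
`K^p`-line of `g₀` (a clean chart, the output of the landed stub 4a `stub_cleanCharts3`) has a projective closure
`M : ProjModel k K` carrying an OPEN `U` (the chart `Spec T`) of clean-regular points which contains the centre of every
valuation ring `𝒪_w ⊇ T` (`exists_model_cleanOn_of_cleanChart`).  Ingredients: the tree's quasi-projectivity of affine
schemes of finite type + schematic image (as in `exists_regCentre_of_hasRegularCentre`), `ofChart_isCentre`, the chart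
computation `modelCleanRegAt_ofChart_of_cleanRegAt_locAtCentre` (`RadicialJungCleanModelsChartStalkSubring.lean`) and a
valuation ring centred at a prescribed prime (`exists_valuationSubring_centre_eq`, `ValuativeDivisibility.lean`).  PROVED;
bookkeeping; nothing here proves resolution in characteristic `p`.
-/

noncomputable section

set_option linter.dupNamespace false -- mandated namespace of this single-conjunct summit

open CategoryTheory AlgebraicGeometry IsLocalRing
open Literature.AlgebraicGeometry.Resolution

namespace Summit.ResolutionOfSingularities.ResolutionOfSingularities.Theorems.RadicialJung.CleanModels

variable {k K : Type} [Field k] [Field K] [Algebra k K] {p : ℕ} {g₀ : K}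

/-- For a subalgebra `T ⊆ K`, the range of `T → K` is `T`. [folklore] -/
theorem range_algebraMap_subalgebra (T : Subalgebra k K) : (algebraMap T K).range = T.toSubring := by
  ext x
  constructor
  · rintro ⟨y, rfl⟩; exact y.2
  · intro hx; exact ⟨⟨x, hx⟩, rfl⟩

/-- **The projective closure of a clean chart.**  If every local ring `locAtCentre T O'` of the finitely generated
`T ⊆ K` (`Frac T = K`) is clean-regular for the `K^p`-line of `g₀`, there is a projective model `M` of `K/k` with an open
`U` of clean-regular points containing the centre of every valuation ring containing `T`.
[cite: CossartPiltant2019, Prop. 4.6 (arXiv v1: Prop. 4.4), proof, Step 3] -/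
theorem exists_model_cleanOn_of_cleanChart (T : Subalgebra k K) (hT : T.FG) [IsFractionRing T K]
    (hclean : ∀ O' : ValuationSubring K, T.toSubring ≤ O'.toSubring →
      CleanRegAt p (locAtCentre T.toSubring O').subtype g₀) :
    ∃ (M : ProjModel k K) (U : M.X.Opens), (∀ x ∈ U, ModelCleanRegAt p g₀ M x) ∧
      ∀ w : ZariskiRiemannSpace k K, T.toSubring ≤ w.asValuationSubring.toSubring → M.centre w ∈ U := by
  haveI : Algebra.FiniteType k T := T.fg_iff_finiteType.mp hT
  let Y : Scheme.{0} := Spec (CommRingCat.of T)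
  let gY : Y ⟶ Spec (.of k) := Spec.map (CommRingCat.ofHom (algebraMap k T))
  haveI : LocallyOfFiniteType gY :=
    (HasRingHomProperty.Spec_iff (P := @LocallyOfFiniteType)).mpr
      (RingHom.finiteType_algebraMap.mpr ‹_›)
  obtain ⟨n, ρ, hρ, hρg⟩ := ChowLemmaProof.exists_immersion_projectiveSpace k gY
  haveI := hρ
  haveI : TopologicalSpace.NoetherianSpace Y := noetherianSpace_of_isImmersion_projectiveSpace ρ
  haveI : QuasiCompact ρ := inferInstance
  haveI : IsIntegral ρ.image := ChowLemmaProof.isIntegral_image ρ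
  haveI : IsProper (Literature.AlgebraicGeometry.Motives.projectiveSpace n k).hom :=
    Literature.AlgebraicGeometry.Motives.isProper_projectiveSpace n k
  let πX : ρ.image ⟶ Spec (.of k) := ρ.imageι ≫ (Literature.AlgebraicGeometry.Motives.projectiveSpace n k).hom
  have hproj : Literature.AlgebraicGeometry.Motives.IsProjectiveOver (Over.mk πX) :=
    ⟨n, Over.homMk ρ.imageι rfl, inferInstanceAs (IsClosedImmersion ρ.imageι)⟩
  have hj : ρ.toImage ≫ πX = Spec.map (CommRingCat.ofHom (algebraMap k T)) := by
    change ρ.toImage ≫ ρ.imageι ≫ (Literature.AlgebraicGeometry.Motives.projectiveSpace n k).hom = _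
    rw [Scheme.Hom.toImage_imageι_assoc, hρg]
  refine ⟨ProjModel.ofChart ρ.image πX hproj T ρ.toImage hj, ρ.toImage.opensRange, fun x hx => ?_, fun w hw => ?_⟩
  · -- a chart point `x = j y` is clean-regular: read its local ring as `locAtCentre T O` for a valuation ring centred at `y`
    obtain ⟨y, rfl⟩ := hx
    obtain ⟨O, hTO, hlt, heq⟩ := exists_valuationSubring_centre_eq T.toSubring y.asIdeal
    have hAO : (algebraMap T K).range ≤ O.toSubring := by rw [range_algebraMap_subalgebra]; exact hTO
    refine modelCleanRegAt_ofChart_of_cleanRegAt_locAtCentre ρ.image πX hproj T ρ.toImage hj y O hAO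
      (fun a => ⟨fun h => ?_, fun h => hlt a h⟩) ?_
    · by_contra hna
      exact absurd (heq a hna) (ne_of_lt h)
    · rw [range_algebraMap_subalgebra]
      exact hclean O hTO
  · -- the centre of `w ⊇ T` lies in the chart
    have hc := ProjModel.ofChart_isCentre ρ.image πX hproj T ρ.toImage hj w
      (Subring.inclusion hw : T.toSubring →+* w.asValuationSubring.toSubring) (fun a => rfl)
    rw [← ProjModel.eq_centre_of_isCentre hc]
    exact ⟨_, rfl⟩

end Summit.ResolutionOfSingularities.ResolutionOfSingularities.Theorems.RadicialJung.CleanModels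

end
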